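import Summits.Ventures.PercRepro.LineCChoice

/-!
# PercRepro — LINE C′ by averaging: p4's averaged contraction inequality gives the `∃k` form, hence C-005 (typer-2, gen 4)

ASSIGNMENTS v30 FACTS (3): p4's AVERAGED FORM `Σ_k CS_B(c|x_k=1) ≤ d · CS_B(c)` (holds for all
single-merge maps at `d ≤ 6`, j156533/4; `d = 7, 8` running, j156536/j156572) implies the `∃k`
form `SingleMergeContractionMonoChoice` by averaging — some facet is at most the mean. This file
types both the single-merge and the all-monotone averaged forms on the `LineC.lean` /
`LineCChoice.lean` vocabulary and composes them with the `∃k` inductions. (The all-monotone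
averaged form is FALSE at `d = 5, 6, 7` — p4 (g4) 08:52:12Z — so only the single-merge form is live.)

* **`SingleMergeAveragedMono`**, **`MonotoneAveragedMono`** — the averaged inequalities (`Prop`s);
* `contractionMonoChoice_of_averaged`, `monotoneContractionMonoChoice_of_averaged` — averaging
  (`Finset.exists_le_of_sum_le` on a nonempty coordinate set);
* **`C005_of_averaged`**, **`C005_of_monotoneAveraged`** — the compositions with
  `C005_of_contractionMonoChoice` / `C005_of_monotoneContractionMonoChoice`.
-/

namespace PercRepro

open Finset

/-- **p4's AVERAGED FORM for single-merge maps**: the top facets' Lemma-B class sums sum to at most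
`d` times the class sum of the map. -/
def SingleMergeAveragedMono : Prop :=
  ∀ {S : Type} [Fintype S] [DecidableEq S] (c : Config S → Setoid (Fin 4)), SingleMergeMap c →
    ∑ k, cubeSumB (facetTop c k) ≤ (Fintype.card S : ℝ) * cubeSumB c

/-- **p4's AVERAGED FORM for all monotone maps** (no single-merge hypothesis) — FALSE: p4 (g4)
08:52:12Z, witnesses at `d = 5, 6, 7` (j156701, j156704, j156706; `CS = 1`, `Σ_k CS(f¹_k) = 8`);
kept only as the hypothesis of the implication `C005_of_monotoneAveraged`. The single-merge form
`SingleMergeAveragedMono` is the live one (`d ≤ 6` verified, `d = 7, 8` running). -/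
def MonotoneAveragedMono : Prop :=
  ∀ {S : Type} [Fintype S] [DecidableEq S] (c : Config S → Setoid (Fin 4)), Monotone c →
    ∑ k, cubeSumB (facetTop c k) ≤ (Fintype.card S : ℝ) * cubeSumB c

section Averaging

variable {S : Type} [Fintype S] [DecidableEq S] [Nonempty S]

/-- Averaging: if the facet sums total at most `d` times the class sum, then some facet is at
most the class sum. -/
theorem exists_facet_le_of_sum_le (c : Config S → Setoid (Fin 4))
    (h : ∑ k, cubeSumB (facetTop c k) ≤ (Fintype.card S : ℝ) * cubeSumB c) :
    ∃ k : S, cubeSumB (facetTop c k) ≤ cubeSumB c := by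
  have hsum : ∑ k : S, cubeSumB (facetTop c k) ≤ ∑ _k : S, cubeSumB c := by
    rw [Finset.sum_const, Finset.card_univ, nsmul_eq_mul]
    exact h
  obtain ⟨k, -, hk⟩ := Finset.exists_le_of_sum_le Finset.univ_nonempty hsum
  exact ⟨k, hk⟩

end Averaging

/-- The averaged form for single-merge maps gives the `∃k` contraction monotonicity. -/
theorem contractionMonoChoice_of_averaged (h : SingleMergeAveragedMono) :
    SingleMergeContractionMonoChoice :=
  fun c hc => exists_facet_le_of_sum_le c (h c hc)

/-- The averaged form for monotone maps gives the `∃k` contraction monotonicity for monotone maps. -/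
theorem monotoneContractionMonoChoice_of_averaged (h : MonotoneAveragedMono) :
    MonotoneContractionMonoChoice :=
  fun c hc => exists_facet_le_of_sum_le c (h c hc)

/-- **The averaged form (single-merge) closes C-005.** -/
theorem C005_of_averaged (h : SingleMergeAveragedMono) : C005 :=
  C005_of_contractionMonoChoice (contractionMonoChoice_of_averaged h)

/-- **The averaged form (all monotone maps) closes C-005.** -/
theorem C005_of_monotoneAveraged (h : MonotoneAveragedMono) : C005 :=
  C005_of_monotoneContractionMonoChoice (monotoneContractionMonoChoice_of_averaged h)

end PercRepro
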